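import Summits.ResolutionOfSingularities.ResolutionOfSingularities.Theorems.FrobeniusClosingSteerArithTransport
import Summits.ResolutionOfSingularities.ResolutionOfSingularities.Theorems.FrobeniusClosingSteerArithTransportSatellite
import HarnessLib

/-!
# Crux `Steer` (stmt-ResolutionOfSingularities-16345), chain W4.1, β-leaf K-β0(b) — the visit induction over res-L0-w41-strat-2's SIX words
# and hS1b only: `arithTransport_of_six_words` (the seventh binder (S-BB) of `arithTransport_of_words` discharged by
# `oddSatelliteSurvivesTwoN_holds`; = res-L0-w41-stub-3's SHAPE PROPOSAL of 2026-08-27 21:16Z, binder for binder)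

OURS (campaign `res-hironaka`, rung L ★L-G4, slot W4.1; seat res-L0-w41-stub-3 g8; RULING 299(b)/(c)). Candidates, not facts; nothing here is a
statement of H. Hironaka's manuscript [Hironaka2017] (status: under review). AI-written; AI review is weaker than expert review. Theses-free,
definition-free. The remaining debts of K-β0(b) `ArithTransportTwoN` are exactly: the six word `_holds` ((F-AB) `BinaryBConeAfterATwoN`, (F-BB)
`BinaryBConeAfterBTwoN`, (T-R) `ReturnIsAStageTwoN`, (P-AB) `AnisotropyPullbackABTwoN`, (P-BB) `AnisotropyPullbackBBTwoN`, (P-BA)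
`AnisotropyPullbackBATwoN` of `…ArithTransportWords`) and hS1b `ArithLeaf.EventuallyConstantReducedOrderTwoN`; the K-β0(a) conclusion stays a
hypothesis of the statement (β-leaf design, `arithPersistence_of`).
-/

-- `Summit.<S>.<S>.…` duplicates the summit name by design (single-problem summit).
set_option linter.dupNamespace false

open IsLocalRing
open Literature.AlgebraicGeometry.Resolution
open Summit.ResolutionOfSingularities.ResolutionOfSingularities.Theorems.SwitchingDichotomy.Words
open Summit.ResolutionOfSingularities.ResolutionOfSingularities.Theorems.SteerRankThinness (Concl HasProperCoarsening)
open Summit.ResolutionOfSingularities.ResolutionOfSingularities.Theorems.SwitchingDichotomy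

namespace Summit.ResolutionOfSingularities.ResolutionOfSingularities.Theorems.SwitchingDichotomy.ArithTransport

/-- **K-β0(b) over the six visit words and hS1b** (`arithTransport_of_words` with (S-BB) discharged by `oddSatelliteSurvivesTwoN_holds`).
OURS. (folklore) -/
theorem arithTransport_of_six_words (hFAB : BinaryBConeAfterATwoN) (hFBB : BinaryBConeAfterBTwoN) (hTR : ReturnIsAStageTwoN)
    (hPAB : AnisotropyPullbackABTwoN) (hPBB : AnisotropyPullbackBBTwoN) (hPBA : AnisotropyPullbackBATwoN)
    (hS1b : ArithLeaf.EventuallyConstantReducedOrderTwoN) :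
    ∀ p : ℕ, p = 2 →
    ∀ (k K : Type) [Field k] [CharP k p] [PerfectField k] [Field K] [Algebra k K]
    (O : ValuationSubring K) (A₀ : Subalgebra k K) (h₀ : A₀.toSubring ≤ O.toSubring) (t : K),
    CoreDatum p 4 k K O A₀ h₀ t → ¬ HasProperCoarsening O →
    ∀ (R : ℕ → Subring K) (P : (i : ℕ) → Ideal (R i)) (s : ℕ → K),
      R 0 = locAtCentre A₀.toSubring O → NormalAt O (R 0) p t → IsSteeredRun O R P t p s →
      (¬ ∃ i₀ c : ℕ, 1 ≤ c ∧ IsDominantTail R P i₀ c) →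
      (∃ i₀ : ℕ, ∀ i, i₀ ≤ i → IsHighOrderAt R s p i) →
      ¬ HeightTwoStepsInfinite R P → {j | IsPosStep R P j}.Infinite →
      (∀ i₀ : ℕ, ∃ i, i₀ ≤ i ∧ IsPointStep R P i ∧
        ∀ hs : s i ^ p ∈ R i, ¬ HasIsolatedSingularity (RadicandRing (R i) p ⟨s i ^ p, hs⟩)) →
      (¬ ∃ i₀ : ℕ, ∃ x : K, x ≠ 0 ∧ x ∈ O ∧ O.valuation x < 1 ∧
        ∀ i, i₀ ≤ i → ∀ y ∈ R i, O.valuation y < 1 → ∃ j, i < j ∧ y / x ∈ R j) →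
      Words.ArithSwitchClause R P s p →
      ∀ d : ℕ, Odd d → 3 ≤ d →
        (∃ i₀ : ℕ, ∀ i, i₀ ≤ i → Words.OddCleanedPointStepAt R P s p i → IsPointStep R P i ∧ BinaryConeE2At R s p d i) →
        ∃ i₀ : ℕ, ∀ i i' : ℕ, i₀ ≤ i → i ≤ i' → Words.OddCleanedPointStepAt R P s p i → IsPointStep R P i ∧ BinaryConeE2At R s p d i →
          Words.ArithBinaryResidueAt R P s p d i' → Words.ArithBinaryResidueAt R P s p d i :=
  arithTransport_of_words hFAB hFBB hTR hPAB hPBB hPBA oddSatelliteSurvivesTwoN_holds hS1b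

end Summit.ResolutionOfSingularities.ResolutionOfSingularities.Theorems.SwitchingDichotomy.ArithTransport
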